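import Literature.NumberTheory.Automorphic.PairLFunctionMeromorphicContinuationNeConjLocalData
import Literature.NumberTheory.Automorphic.PairLFunctionNeConjGlobalRankinSelbergTranslate
import Literature.NumberTheory.Automorphic.RankinSelbergTorusHolomorphy
import HarnessLib

/-!
# Corollaire (i)(b) of Mœglin–Waldspurger for ONE pair, from TRANSLATED local Rankin–Selberg data
(additive character of arbitrary conductor off `S'`)

Topic `NumberTheory/Automorphic`; namespace `Literature.NumberTheory.Automorphic`. Proof file (theorems
only). `exists_entire_eq_partialPairL_of_localData` (`PairLFunctionMeromorphicContinuationNeConjLocalData`)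
derives the conclusion of the named fact `MoeglinWaldspurger1989_partialPairL_entire_of_ne_conj` for ONE
pair `π ≠ σ̄` from finitely many data of the Rankin–Selberg method, the `S'_i`-parts being the unit-box
integrals `Ψ_{S'_i}(s)` of the global Whittaker coefficients — under the hypothesis that off `S'_i` the
standard character `ψ_K` is unramified (`v ∤ 𝔡_K`), which for a field with non-trivial different forces
the places above the different into every `S'_i`. This file removes that constraint: the `S'_i`-parts are
replaced by their TRANSLATES by a torus element `τ` realising the Whittaker shifts
`diag(ϖ_v^{-e_v(n-1)}, …, ϖ_v^{-e_v}, 1)` at the places where `ψ_{K,v}` has conductor `ϖ_v^{-e_v}𝒪_v`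
(`exists_entire_eq_partialPairL_of_localData_translate`); the proof is that of the source theorem with
the translated global theorems of `PairLFunctionNeConjGlobalRankinSelbergTranslate` and the entire
nowhere-zero weight `w_s(τ)` divided into `B`. For level-one pairs this makes `S'_i = ∅` available over
EVERY number field (Cogdell (2004), §3.1: unnormalised `ψ_v`).

## References

* C. Mœglin, J.-L. Waldspurger, *Le spectre résiduel de GL(n)*, Ann. Sci. ÉNS 22 (1989), Appendice,
  Corollaire (i)(b), p. 667 [MoeglinWaldspurger1989].
* J. W. Cogdell, *Analytic theory of L-functions for GL_n* (2004), §3.1, §4.1–§4.2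
  [CogdellAnalyticTheory2004].
* H. Jacquet, J. A. Shalika, Amer. J. Math. 103 (1981), I §4 [JacquetShalikaAJM1981].
-/

noncomputable section

open MeasureTheory Measure NumberField IsDedekindDomain Matrix Set Filter Topology
open scoped ENNReal NNReal ComplexConjugate

namespace Literature.NumberTheory.Automorphic

open Literature.NumberTheory.GaloisRepresentations (ideleGroup HeckeCharacter)

-- the automorphic quotient carries the tree's Borel σ-algebra, not Mathlib's quotient σ-algebra
-- (verbatim from `RankinSelbergUnfoldingIdentity`)
attribute [-instance] Quotient.instMeasurableSpace QuotientGroup.measurableSpace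

section LocalDataTranslate

open ValuativeRel

variable {n : ℕ} {K : Type} [Field K] [NumberField K]
variable {μ' : Measure (AdelicGroupData.gl n K).automorphicQuotient} [(AdelicGroupData.gl n K).IsAutomorphicMeasure μ']
variable [MeasurableSpace (AdeleRing (𝓞 K) K)] [BorelSpace (AdeleRing (𝓞 K) K)]

-- the house local instances, exactly as in `RankinSelbergUnfoldingIdentity`
attribute [local instance] adelicBorel borelSpace_adelic locallyCompactSpace_adelic secondCountableTopology_gl_adelic
  glAdeleBorel borelSpace_glAdele borelSpace_ideleGroup secondCountableTopology_ideleGroup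

/-- **Corollaire (i)(b) for one pair from TRANSLATED local Rankin–Selberg data (additive character of
any conductor).** As `exists_entire_eq_partialPairL_of_localData`, but the sets `S'_i` need only avoid the
levels `𝔫_i` (NOT the different): instead a torus element `τ ∈ (𝔸_Kˣ)ⁿ` with last entry `1` is given
whose `v`-component, for every `v ∉ S'_i`, is a diagonal shift `diag(d)` of constant ratio `a_v` with
`ψ_{K,v}(a_v ·)` of conductor `𝒪_v` (the Whittaker shift at `v ∣ 𝔡_K`), and the identity
`B(s) ∑_i c_i (∏_{v ∈ S'_i ∖ S₀} P_v(q_v^{-s})) Ψ^τ_{S'_i}(s) = 1` on the strip is required for the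
TRANSLATED `S'`-parts `Ψ^τ_{S'_i}(s) = ∫_{B({v ∉ S'_i}) × K} W_i(diag τ ·) W̄'_i(diag τ ·) Φ_i(e_n ·) |det|^s δ_B⁻¹`.
Then `partialPairL S₀ α β` extends to an entire function: by the translated global theorems
(`PairLFunctionNeConjGlobalRankinSelbergTranslate`) `∑ c_i F_i = s (s - 1) C w_s(τ) L^{S₀} ∑ c_i ∏ P_v Ψ^τ_i`
with `w_s(τ) = |det τ|^s δ_B(τ)⁻¹` entire and nowhere zero, so `L^{S₀} = C⁻¹ (B / w(τ)) ∑ c_i F_i /(s (s - 1))`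
with the residues at `1`, `0` vanishing as in the untranslated case (Cogdell (2004), §4.1–§4.2, §3.1).
[cite: MoeglinWaldspurger1989, Appendice, Corollaire (i)(b), p. 667] [cite: CogdellAnalyticTheory2004, §3.1, §4.1–§4.2] -/
theorem exists_entire_eq_partialPairL_of_localData_translate
    (νI : Measure (ideleGroup K)) [νI.IsHaarMeasure]
    (νA : Measure (Fin n → ideleGroup K)) [IsHaarMeasure νA]
    (νK : Measure ↥(maximalCompactAdelic n K)) [IsHaarMeasure νK]
    (ν₀ : Measure ↥(adelicUnipotent n K)) [IsHaarMeasure ν₀]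
    (hn : 0 < n) (h₁ : multiplicity_one_gl n K μ')
    (P P' : CuspidalAutomorphicRepGL n K μ') (hne : P ≠ P'.conj)
    {S₀ : Set (HeightOneSpectrum (𝓞 K))} {α β : SatakeFamily K}
    (hα : IsSatakeFamilyOf P S₀ α) (hβ : IsSatakeFamilyOf P' S₀ β)
    {m : ℕ} (c : Fin m → ℂ) (f : Fin m → P.1.toSubmodule) (f' : Fin m → P'.conj.1.toSubmodule)
    {𝔫₀ : Fin m → Ideal (𝓞 K)} (h𝔫₀ : ∀ i, 𝔫₀ i ≠ 0)
    {η : Fin m → (AdelicGroupData.gl n K).Adelic → ℝ} (hη : ∀ i, IsTestFunctionGL n K (η i))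
    (hηK : ∀ i, ∀ k : (AdelicGroupData.gl n K).Adelic, k ∈ principalCongruenceLevel n K (𝔫₀ i) →
      ∀ g : (AdelicGroupData.gl n K).Adelic, η i (k * g) = η i g)
    {S' : Fin m → Set (HeightOneSpectrum (𝓞 K))} (hS'f : ∀ i, (S' i \ S₀).Finite) (hS₀S' : ∀ i, S₀ ⊆ S' i)
    (hS' : ∀ i, ∀ v ∉ S' i, ¬ v.asIdeal ∣ 𝔫₀ i)
    (τ : Fin n → ideleGroup K) (hτ : lastEntry τ = 1)
    (hτψ : ∀ i, ∀ v ∉ S' i, ∃ (d : Fin n → (v.adicCompletion K)ˣ) (a : (v.adicCompletion K)ˣ),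
      localComponent v (glDiagonal n (AdeleRing (𝓞 K) K) τ) = diagonalGL (Fin n) (v.adicCompletion K) d ∧
      (∀ i j : Fin n, (i : ℕ) + 1 = j →
        (d i : v.adicCompletion K) * ((d j)⁻¹ : (v.adicCompletion K)ˣ) = a) ∧
      (∀ c ∈ 𝒪[v.adicCompletion K], (adeleAddChar K).adicComponent v (a * c) = 1) ∧
      ∀ ϖ : v.adicCompletion K, Valued.v ϖ = WithZero.exp (-1 : ℤ) →
        ∃ c ∈ 𝒪[v.adicCompletion K], (adeleAddChar K).adicComponent v (a * (ϖ⁻¹ * c)) ≠ 1)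
    {x y : Fin m → HeightOneSpectrum (𝓞 K) → Fin n → ℂ}
    (hx : ∀ i, ∀ v ∉ S' i, (Finset.univ : Finset (Fin n)).val.map (x i v) = α v)
    (hy : ∀ i, ∀ v ∉ S' i, (Finset.univ : Finset (Fin n)).val.map (y i v) = (β v).map conj)
    {Φinf : Fin m → (Fin n → InfiniteAdeleRing K) → ℝ} (hΦc : ∀ i, Continuous (Φinf i))
    (hΦ0 : ∀ i, ∀ z, 0 ≤ Φinf i z)
    (hΦS : ∀ i, (fun v => ((standardTestFun n K (Φinf i) v : ℝ) : ℂ)) ∈ piSchwartzBruhat K (Fin n))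
    {B : ℂ → ℂ} (hB : Differentiable ℂ B)
    (hBsum : ∀ s : ℂ, 1 < s.re → s.re < 2 →
      B s * (∑ i, c i * ((∏ v ∈ (hS'f i).toFinset,
          (satakePairPolynomial (α v) (β v)).eval ((v.residueCard : ℂ) ^ (-s))) *
        ∫ p in unitBox {v | v ∉ S' i} ×ˢ Set.univ, torusPairIntegrandC n K
          (fun g => whittakerCoeff ν₀ (unipotentTateDomain n K) (adeleAddChar K)
            (invQuot (AdelicGroupData.gl n K) (smoothedForm (η i) ((f i : P.1.toSubmodule) : (AdelicGroupData.gl n K).L2 μ')))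
            (glDiagonal n (AdeleRing (𝓞 K) K) τ * g))
          (fun g => (star (whittakerCoeff ν₀ (unipotentTateDomain n K) (adeleAddChar K)
            (invQuot (AdelicGroupData.gl n K) (smoothedForm (η i) ((f' i : P'.conj.1.toSubmodule) : (AdelicGroupData.gl n K).L2 μ')))))
            (glDiagonal n (AdeleRing (𝓞 K) K) τ * g))
          (standardTestFun n K (Φinf i)) s p ∂(νA.prod νK))) = 1) :
    ∃ g : ℂ → ℂ, Differentiable ℂ g ∧ ∀ s : ℂ, 1 < s.re → g s = partialPairL S₀ α β s := by
  classical
  -- unramified Euler factors at `S'_i ∖ S₀` and their non-vanishing on `re s > 1`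
  have hββ : (fun v => ((β v).map conj).map conj) = β := funext fun v => multiset_map_conj_map_conj _
  have hmul : ∀ (i : Fin m) (s : ℂ), 1 < s.re → Multipliable fun v : {v : HeightOneSpectrum (𝓞 K) // v ∉ S' i} =>
      ((satakePairPolynomial (α v.1) (β v.1)).eval ((v.1.residueCard : ℂ) ^ (-s)))⁻¹ := fun i s hs =>
    JacquetShalika1981_multipliable_partialPairL_holds P P' (hα.mono (hS₀S' i)) (hβ.mono (hS₀S' i)) hs
  have hPne : ∀ (i : Fin m) (s : ℂ), 1 < s.re → ∀ v ∈ (hS'f i).toFinset,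
      (satakePairPolynomial (α v) (β v)).eval ((v.residueCard : ℂ) ^ (-s)) ≠ 0 := fun i s hs v hv =>
    eval_satakePairPolynomial_ne_zero_of_one_lt_re P P' hα hβ ((hS'f i).mem_toFinset.1 hv).2 hs
  by_cases hω : (∀ z : ideleGroup K, ∃ c : ℂ, ‖c‖ = 1 ∧
        (∀ f : P.1.toSubmodule,
          (AdelicGroupData.gl n K).rightRegular μ' (Matrix.GeneralLinearGroup.scalar (Fin n) z)
              (f : (AdelicGroupData.gl n K).L2 μ') = c • (f : (AdelicGroupData.gl n K).L2 μ')) ∧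
        (∀ f' : P'.conj.1.toSubmodule,
          (AdelicGroupData.gl n K).rightRegular μ' (Matrix.GeneralLinearGroup.scalar (Fin n) z)
              (f' : (AdelicGroupData.gl n K).L2 μ') = c • (f' : (AdelicGroupData.gl n K).L2 μ')))
  · /- a common central action: the untwisted global theorem, residues at `1` and `0` -/
    obtain ⟨C, hC, hT⟩ :=
      exists_entire_eq_mul_partialPairL_mul_setIntegral_pair_translate (n := n) (K := K) hn μ' νI νA νK ν₀
    have hZ : ∀ (i : Fin m) (z : ideleGroup K), ∃ c : ℂ, ‖c‖ = 1 ∧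
        (AdelicGroupData.gl n K).rightRegular μ' (Matrix.GeneralLinearGroup.scalar (Fin n) z)
            ((f i : P.1.toSubmodule) : (AdelicGroupData.gl n K).L2 μ') =
          c • ((f i : P.1.toSubmodule) : (AdelicGroupData.gl n K).L2 μ') ∧
        (AdelicGroupData.gl n K).rightRegular μ' (Matrix.GeneralLinearGroup.scalar (Fin n) z)
            ((f' i : P'.conj.1.toSubmodule) : (AdelicGroupData.gl n K).L2 μ') =
          c • ((f' i : P'.conj.1.toSubmodule) : (AdelicGroupData.gl n K).L2 μ') := fun i z => by
      obtain ⟨d, hd, hP, hQ⟩ := hω z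
      exact ⟨d, hd, hP (f i), hQ (f' i)⟩
    choose F hF hFI hFstrip hF1 using fun i : Fin m =>
      hT P P'.conj (f i) (f' i) (hZ i) hα hβ.conj (h𝔫₀ i) (hη i) (hηK i) (hS₀S' i) (hS' i) τ hτ (hτψ i) (hx i)
        (hy i) (hΦc i) (hΦ0 i) (hΦS i)
    -- the residues of every `F_i` at `s = 1` and `s = 0`
    have hF1' : ∀ i, F i 1 = 0 := fun i => hF1 i h₁ hne
    have hF0' : ∀ i, F i 0 = 0 := fun i =>
      apply_zero_eq_zero_of_entire_eq_mul_rankinSelbergIntegral_of_ne_conj hn h₁ νI P P' hne (f i) (f' i) (hη i)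
        (hΦS i) (hF i) (hFI i)
    -- `∑ c_i F_i = s (s - 1) · C · w_s(τ) · L^{S₀} · ∑ c_i A^τ_i` on the strip
    have hsum : ∀ s : ℂ, 1 < s.re → s.re < 2 →
        ∑ i, c i * F i s = (s * (s - 1) * (C : ℂ) * torusWeightC n K s τ * partialPairL S₀ α β s) *
          ∑ i, c i * ((∏ v ∈ (hS'f i).toFinset,
                  (satakePairPolynomial (α v) (β v)).eval ((v.residueCard : ℂ) ^ (-s))) *
                ∫ p in unitBox {v | v ∉ S' i} ×ˢ Set.univ, torusPairIntegrandC n K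
                  (fun g => whittakerCoeff ν₀ (unipotentTateDomain n K) (adeleAddChar K)
                    (invQuot (AdelicGroupData.gl n K) (smoothedForm (η i) ((f i : P.1.toSubmodule) : (AdelicGroupData.gl n K).L2 μ')))
                    (glDiagonal n (AdeleRing (𝓞 K) K) τ * g))
                  (fun g => (star (whittakerCoeff ν₀ (unipotentTateDomain n K) (adeleAddChar K)
                    (invQuot (AdelicGroupData.gl n K) (smoothedForm (η i) ((f' i : P'.conj.1.toSubmodule) : (AdelicGroupData.gl n K).L2 μ')))))
                    (glDiagonal n (AdeleRing (𝓞 K) K) τ * g))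
                  (standardTestFun n K (Φinf i)) s p ∂(νA.prod νK)) := by
      intro s hs1 hs2
      rw [Finset.mul_sum]
      refine Finset.sum_congr rfl fun i _ => ?_
      have h := hFstrip i s hs1 hs2
      beta_reduce at h
      rw [hββ] at h
      have hP0 : (∏ v ∈ (hS'f i).toFinset,
                  (satakePairPolynomial (α v) (β v)).eval ((v.residueCard : ℂ) ^ (-s))) ≠ 0 :=
        Finset.prod_ne_zero_iff.2 (hPne i s hs1)
      rw [h, partialPairL_eq_prod_mul_partialPairL (hS₀S' i) (hS'f i) α β (hmul i s hs1), Finset.prod_inv_distrib]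
      field_simp
    -- the entire function `G = C⁻¹ B ∑ c_i F_i`
    set G : ℂ → ℂ := fun s => (C : ℂ)⁻¹ * ((torusWeightC n K s τ)⁻¹ * (B s * ∑ i, c i * F i s)) with hGdef
    have hC0 : (C : ℂ) ≠ 0 := Complex.ofReal_ne_zero.2 hC.ne'
    have hsumF : Differentiable ℂ fun s => ∑ i, c i * F i s := by
      have h : Differentiable ℂ (∑ i, fun s => c i * F i s) := Differentiable.sum fun i _ => (hF i).const_mul (c i)
      convert h using 1
      funext s
      simp only [Finset.sum_apply]
    have htw : Differentiable ℂ fun s => (torusWeightC n K s τ)⁻¹ :=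
      (differentiable_torusWeightC τ).inv fun s => torusWeightC_ne_zero s τ
    have hG : Differentiable ℂ G := by
      show Differentiable ℂ fun s => (C : ℂ)⁻¹ * ((torusWeightC n K s τ)⁻¹ * (B s * ∑ i, c i * F i s))
      exact (htw.mul (hB.mul hsumF)).const_mul _
    have hGstrip : ∀ s : ℂ, 1 < s.re → s.re < 2 → G s = s * (s - 1) * partialPairL S₀ α β s := by
      intro s hs1 hs2
      have h1 := hBsum s hs1 hs2
      have htw0 := torusWeightC_ne_zero (n := n) (K := K) s τ
      show (C : ℂ)⁻¹ * ((torusWeightC n K s τ)⁻¹ * (B s * ∑ i, c i * F i s)) = _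
      rw [hsum s hs1 hs2, mul_left_comm (B s), h1, mul_one]
      field_simp
    have hGL : ∀ s : ℂ, 1 < s.re → G s = s * (s - 1) * partialPairL S₀ α β s :=
      eq_mul_partialPairL_of_eqOn_strip P P' hα hβ hG (differentiable_id.mul (differentiable_id.sub_const 1)) hGstrip
    have hG1 : G 1 = 0 := by
      show (C : ℂ)⁻¹ * ((torusWeightC n K 1 τ)⁻¹ * (B 1 * ∑ i, c i * F i 1)) = 0
      rw [Finset.sum_eq_zero fun i _ => by rw [hF1' i, mul_zero], mul_zero, mul_zero, mul_zero]
    have hG0 : G 0 = 0 := by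
      show (C : ℂ)⁻¹ * ((torusWeightC n K 0 τ)⁻¹ * (B 0 * ∑ i, c i * F i 0)) = 0
      rw [Finset.sum_eq_zero fun i _ => by rw [hF0' i, mul_zero], mul_zero, mul_zero, mul_zero]
    exact exists_entire_eq_of_entire_mul_of_apply_eq_zero hG hG0 hG1 hGL
  · /- no common central action: the twisted global theorem -/
    -- the central characters of `π` and `σ̄` differ
    obtain ⟨ω, hωu, hωA, hωact, hωS, -, -⟩ := P.exists_centralCharacter_smoothedForm
    obtain ⟨ω', hω'u, hω'A, hω'act, hω'S, -, -⟩ := P'.conj.exists_centralCharacter_smoothedForm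
    have hωne : ω ≠ ω' := by
      intro hωeq
      refine hω fun z => ⟨((ω z : ℂˣ) : ℂ), hωu z, fun f => ?_, fun f' => ?_⟩
      · have h := congrArg Subtype.val (hωact z f)
        rw [ContRepresentation.ClosedSubrep.coe_toContRep_apply, Submodule.coe_smul] at h
        exact h
      · have h := congrArg Subtype.val (hω'act z f')
        rw [ContRepresentation.ClosedSubrep.coe_toContRep_apply, Submodule.coe_smul, ← hωeq] at h
        exact h
    set χ : HeckeCharacter K := ω * ω'⁻¹ with hχ
    have hχ1 : χ ≠ 1 := by
      intro h
      apply hωne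
      have h' := congrArg (· * ω') h
      simpa only [hχ, inv_mul_cancel_right, one_mul] using h'
    have hχ₀ : ∀ t : ℝ≥0ˣ, χ (posRealIdele K t) = 1 := fun t => by
      rw [hχ, HeckeCharacter.mul_apply, HeckeCharacter.inv_apply, hωA t, hω'A t, inv_one, mul_one]
    -- the twisted global theorem
    obtain ⟨C, hC, hT⟩ :=
      exists_entire_eq_partialPairL_mul_setIntegral_pair_twisted_translate (n := n) (K := K) hn μ' νI νA νK ν₀
    choose F hF hFI hFstrip using fun i : Fin m =>
      hT P P'.conj (f i) (f' i) hωu hω'u hχ hχ1 hχ₀ hα hβ.conj (h𝔫₀ i) (hη i) (hηK i)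
        (fun z g => hωS (η i) (f i) z g) (fun z g => hω'S (η i) (f' i) z g) (hS₀S' i) (hS' i) τ hτ (hτψ i)
        (hx i) (hy i) (hΦc i) (hΦ0 i) (hΦS i)
    -- `∑ c_i F_i = C · w_s(τ) · L^{S₀} · ∑ c_i A^τ_i` on the strip
    have hsum : ∀ s : ℂ, 1 < s.re → s.re < 2 →
        ∑ i, c i * F i s = ((C : ℂ) * torusWeightC n K s τ * partialPairL S₀ α β s) *
          ∑ i, c i * ((∏ v ∈ (hS'f i).toFinset,
                  (satakePairPolynomial (α v) (β v)).eval ((v.residueCard : ℂ) ^ (-s))) *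
                ∫ p in unitBox {v | v ∉ S' i} ×ˢ Set.univ, torusPairIntegrandC n K
                  (fun g => whittakerCoeff ν₀ (unipotentTateDomain n K) (adeleAddChar K)
                    (invQuot (AdelicGroupData.gl n K) (smoothedForm (η i) ((f i : P.1.toSubmodule) : (AdelicGroupData.gl n K).L2 μ')))
                    (glDiagonal n (AdeleRing (𝓞 K) K) τ * g))
                  (fun g => (star (whittakerCoeff ν₀ (unipotentTateDomain n K) (adeleAddChar K)
                    (invQuot (AdelicGroupData.gl n K) (smoothedForm (η i) ((f' i : P'.conj.1.toSubmodule) : (AdelicGroupData.gl n K).L2 μ')))))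
                    (glDiagonal n (AdeleRing (𝓞 K) K) τ * g))
                  (standardTestFun n K (Φinf i)) s p ∂(νA.prod νK)) := by
      intro s hs1 hs2
      rw [Finset.mul_sum]
      refine Finset.sum_congr rfl fun i _ => ?_
      have h := hFstrip i s hs1 hs2
      beta_reduce at h
      rw [hββ] at h
      have hP0 : (∏ v ∈ (hS'f i).toFinset,
                  (satakePairPolynomial (α v) (β v)).eval ((v.residueCard : ℂ) ^ (-s))) ≠ 0 :=
        Finset.prod_ne_zero_iff.2 (hPne i s hs1)
      rw [h, partialPairL_eq_prod_mul_partialPairL (hS₀S' i) (hS'f i) α β (hmul i s hs1), Finset.prod_inv_distrib]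
      field_simp
    -- the entire function `G = C⁻¹ B ∑ c_i F_i`
    set G : ℂ → ℂ := fun s => (C : ℂ)⁻¹ * ((torusWeightC n K s τ)⁻¹ * (B s * ∑ i, c i * F i s)) with hGdef
    have hC0 : (C : ℂ) ≠ 0 := Complex.ofReal_ne_zero.2 hC.ne'
    have hsumF : Differentiable ℂ fun s => ∑ i, c i * F i s := by
      have h : Differentiable ℂ (∑ i, fun s => c i * F i s) := Differentiable.sum fun i _ => (hF i).const_mul (c i)
      convert h using 1
      funext s
      simp only [Finset.sum_apply]
    have htw : Differentiable ℂ fun s => (torusWeightC n K s τ)⁻¹ :=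
      (differentiable_torusWeightC τ).inv fun s => torusWeightC_ne_zero s τ
    have hG : Differentiable ℂ G := by
      show Differentiable ℂ fun s => (C : ℂ)⁻¹ * ((torusWeightC n K s τ)⁻¹ * (B s * ∑ i, c i * F i s))
      exact (htw.mul (hB.mul hsumF)).const_mul _
    have hGstrip : ∀ s : ℂ, 1 < s.re → s.re < 2 → G s = (fun _ : ℂ => (1 : ℂ)) s * partialPairL S₀ α β s := by
      intro s hs1 hs2
      have h1 := hBsum s hs1 hs2
      have htw0 := torusWeightC_ne_zero (n := n) (K := K) s τ
      show (C : ℂ)⁻¹ * ((torusWeightC n K s τ)⁻¹ * (B s * ∑ i, c i * F i s)) = 1 * partialPairL S₀ α β s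
      rw [hsum s hs1 hs2, mul_left_comm (B s), h1, mul_one]
      field_simp
    have hGL : ∀ s : ℂ, 1 < s.re → G s = (fun _ : ℂ => (1 : ℂ)) s * partialPairL S₀ α β s :=
      eq_mul_partialPairL_of_eqOn_strip P P' hα hβ hG (differentiable_const _) hGstrip
    exact ⟨G, hG, fun s hs => by rw [hGL s hs, one_mul]⟩

end LocalDataTranslate

end Literature.NumberTheory.Automorphic
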